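import Literature.MathematicalPhysics.QuantumFieldTheory.BalabanImbrieJaffe1984to88.BIJ88LocDeriv230FlatTorus

/-!
# `BalabanImbrieJaffe1984to88.BIJ88LocHolder230FlatTorus` — T. Bałaban, J. Imbrie, A. Jaffe, *Effective action and cluster properties of
the abelian Higgs model*, Commun. Math. Phys. **114** (1988) 257–315 [BalabanImbrieJaffe1988], Sect. 2 p. 263 [PDF 7], the sentence after
(2.33): *"Bounds analogous to (2.30), (2.31) hold for covariant derivatives and Hölder derivatives of G_{k,loc}(u) of order less than two"* —
**THE HÖLDER MEMBER OF ORDER `θ ≤ 1` OF (2.30) AT EVERY PURE-GAUGE BACKGROUND `u = 1^h` FOR THE PRINTED LOCALIZATION DATA** (the torus cubes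
`{□_α}`, the weights `λ_α` of (2.27) and the cut-off `ζ″` of (2.29) of gen 26's `BIJ88LocWeights227Torus`): the gauge-covariant Hölder quotient
`(L^k/|x₁ − x₂|_T)^θ·|u(Γ_{x₁x₂})(G_{k,loc}(1^h)f)(x₂) − (G_{k,loc}(1^h)f)(x₁)|` of the VALUES of `G_{k,loc}(1^h)f` obeys the (2.30)-type bound
`(L^kε)²·C·e^{−δ₀ dist(suppt f, {x₁,x₂})/L^k}‖f‖_∞` for every pair of points deep inside `Ω₀`, every `0 ≤ θ ≤ 1`.

statement-level skeleton of published theorems with citation tags; proofs where landed; nothing here is a claim about the Yang–Mills mass gap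

PDF held: `paper:balaban1988-cmp114-bij-abelian-higgs-effective-action` (journal page = PDF page + 256); p. 263–264 [PDF 7–8] re-read this
session from the text layer (`lit read … --pages 5-9`).

CITATION HEADER (lean-in-tree rule).  Part of the lit-balaban TYPED SKELETON (HOME `run/shared/lean/pub/lit-balaban/`), PHASE-2 proof seat
p29 gen 28 (unit `lit-balaban-p29-g28`; TAKING line HOME/STATUS.md 2026-08-22T22:01:27Z; free-target protocol G.5-34(d) — own lineage, the
gen-27 HANDOFF item *"Hölder members of (2.30)/(2.31) for G_{k,loc}"*).  Row **C2.Claim@263** (owner r18; head = p08's abstract hence-step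
`BIJ88HolderDecay230.holderOpDecay230` over REAL kernels with a DISPLAYED output-Lipschitz hypothesis — unchanged; the value members for the
data are gen 26/27's `BIJ88LocWeights227Torus.opDecay230_flat_cwt`, the covariant-derivative member is gen 27's
`BIJ88LocDeriv230FlatTorus.deriv230_flat_cwt`).  This file supplies the HÖLDER MEMBER OF ORDER `θ ∈ [0, 1]` (Hölder quotients of the values) FOR
`G_{k,loc}` ITSELF, for the data, with the gauge-covariant (parallel-transported) difference of [6] (1.9) written out at `u = 1^h` as in p31's
`BIJ88NeumannPropagatorFlatDecayCube.holder19_flat_cube`.  Kind: theorems only (no definition, no `Prop`-valued fact; nothing restated).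

THE PRINTED TEXT (verbatim, p. 263).  *"The boundary conditions are always at a distance O(r(e_k)) from x₁, x₂, so a straightforward application
of the random walk expansion of [6] shows that |(G_{k,loc}(u)f)(x)| ≦ ce^{−c dist(suppt f,x)}‖f‖_∞, (2.30) … for dist(x,Ω^c) ≧ O(r(e_k)). …
Bounds analogous to (2.30), (2.31) hold for covariant derivatives and Holder derivatives of G_{k,loc}(u) of order less than two."*  [6] =
[Balaban1983RegularityDecay]: (1.9) is the Hölder member of order `1 + α` (Hölder quotients of `D^η_uG f`, weight `|x − x′|^{−α}` in `T_η`-units,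
transport `U(A(Γ_{x,x′}))`), (1.10) the value and derivative members; "order less than two" for the ORDER-`θ ≤ 1` quotients of the values is the
interpolation of (1.10)'s two members — this file; the order `1 + θ` member is the companion `BIJ88LocDerivHolder230FlatTorus`.

THE MECHANISM (ours, declared; print says only *"analogous"*).  At `u = 1^h` the transport along any contour from `x₂` to `x₁` is
`h(x₁)h(x₂)⁻¹`, and with `Φ = h̄·ψ`, `ψ = G_{k,loc}(1^h)f`: `h(x₁)h(x₂)⁻¹ψ(x₂) − ψ(x₁) = h(x₁)(Φ(x₂) − Φ(x₁))`, while across one bond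
`Φ(b₊) − Φ(b₋) = h(b₋)⁻¹·ε·(D^ε_uψ)(b)` (§2).  NEAR PAIRS `|x₁ − x₂|_T ≤ L^k`: a torus-close pair deep inside the no-wrap box `Ω₀` is chart-close
(gen 26 `mem_and_abs_sub_le_of_T_le`, `L^k ≤ R₀ ≤` depth), so `Φ(x₂) − Φ(x₁)` TELESCOPES along a coordinate-monotone staircase of
`≤ (d+1)|x₁ − x₂|_T` bonds inside the coordinate hull of `{x₁, x₂}` (§1, an `ℓ¹` induction in the chart; every hull point is as deep as the
shallower endpoint and within `|x₁ − x₂|_T` of `x₁`, so gen 27's `deriv230_flat_cwt` applies on every bond with the support distance shortened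
by `|x₁ − x₂|_T ≤ L^k`, costing `e^{δ₀}`); then `(L^k/T)^θ·(d+1)T·ε·(L^kε)(…) ≤ (d+1)(L^kε)²(…)` because `(L^k/T)^θ ≤ L^k/T` for `T ≤ L^k`,
`θ ≤ 1`.  FAR PAIRS `|x₁ − x₂|_T ≥ L^k`: `(L^k/T)^θ ≤ 1` and two value members `opDecay230_flat_cwt`.

WHAT IS PROVED (theorems only; 0 `sorry`; standard axioms).
* §1 `norm_sub_le_mul_l1_of_bond_bound` — lattice telescoping in a coordinate box of `ℤ^m` under a per-bond bound (any seminormed group).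
* §2 `cfg_gaugeAct_one` (`u(b) = h(b₋)h(b₊)⁻¹` at `u = 1^h`), `rot_tgt_sub_rot_src` / `norm_rot_tgt_sub_rot_src` (`Φ(b₊) − Φ(b₋)` against
  `D^ε_uψ(b)`), `transport_sub_eq` / `norm_transport_sub` (the transported difference against `Φ(x₂) − Φ(x₁)`).
* §3 **`holder230_flat_cwt`** — THERE EXIST `δ₀, c₀ > 0` depending on `(d, ℓ, a)` only such that for every volume (`P.d = d+1`, `P.L = ℓ+1`),
  every `1 ≤ k ≤ K`, every no-wrap box `Ω₀ = c·L^k + Π_i[0, L^kM₀_i)` shorter than the torus leaving torus gaps `≥ R` and `≥ R₀`, cube spacing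
  `s ≥ 1`, half-width `W ≥ 2s/3 + R₀/2 + R`, radii `1 < R`, `0 ≤ R₁ < R₀`, `L^k ≤ R₀`, every pure gauge `h`, EVERY `0 ≤ θ ≤ 1`, all `x₁, x₂ ∈ Ω₀`
  of chart depth `≥ R₀` and every `f` with `‖f‖_∞ ≤ F` supported at sup-torus distance `≥ D ≥ 0` from `x₁` and from `x₂`:
  `(L^k/|x₁−x₂|_T)^θ·‖h(x₁)h(x₂)⁻¹(G_{k,loc}(1^h)f)(x₂) − (G_{k,loc}(1^h)f)(x₁)‖ ≤ (L^kε)²·c₀·m·(1 + L^k((R₀−R₁)⁻¹ + s⁻¹))·e^{−δ₀D/L^k}·F`,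
  `m = (⌊(L^k − 1 + R₀)/s⌋ + 3)^{d+1}` — the printed *"bounds analogous to (2.30) … for Hölder derivatives of order less than"* ONE of
  `G_{k,loc}` at flat `u`, for the printed localization, uniformly in `θ ∈ [0,1]`, in [6]'s level-`k` units.
HONEST SCOPE.  (i) FLAT / PURE-GAUGE BACKGROUNDS ONLY (the (2.32)-smooth case is XL).  (ii) ORDERS `θ ≤ 1` (values) only here; the order
`1 + θ` member (Hölder quotients of `D^ε_uG_{k,loc}f`, [6] (1.9)-type) needs second differences of the row weights and is the companion file's;
the (2.31)-analogues (closeness to `G_k(Ω₀)`) for Hölder quotients are NOT here.  (iii) Both points at chart depth `≥ R₀ ≥ L^k` in the no-wrap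
box `Ω₀` (gen 26 (b), (c)); `R > 1`; both torus gaps (gen 27's `R` for the derivative member, gen 26's `R₀` for the value member) are carried
as printed by those theorems.  (iv) Constants: `c₀ = max((d+1)e^{δ₁}c₁, 2c₂)`, `δ₀ = min(δ₁, δ₂)` over gen 27's/gen 26's pairs, the explicit
bracket `1 + L^k((R₀−R₁)⁻¹ + s⁻¹)` (`O(1)` at the printed radii) — not optimized; at `θ = 1` the statement is the plain (transported)
difference quotient in level-`k` units.  Imports: gen 27 `BIJ88LocDeriv230FlatTorus` (→ gen 26 `BIJ88LocWeights227Torus` → p31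
`BIJ88DeltaLocFlatClose235`, `…FlatDecayCube`; p13 `BIJ88ConvexWeights227`, `BIJ88Cutoffs21`).  Literature + Mathlib only.
Unit `lit-balaban-p29` (literature-prover-lit-balaban-p29-g28-0), 2026-08-22.  NOT summit progress.
-/

open scoped BigOperators Matrix ComplexConjugate
open Finset Matrix Set

namespace Literature.MathematicalPhysics.QuantumFieldTheory.BalabanImbrieJaffe1984to88.BIJ88LocHolder230FlatTorus

open Literature.MathematicalPhysics.QuantumFieldTheory.Balaban1983to89
open BIJ88Sect3Statements (U1 toC cfg covD toC_mul toC_one norm_toC)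
open BIJ85BlockAveragesTorus BIJ85BlockAveragesTorusK
open BIJ88NeumannPropagator227Torus (gBox)
open BIJ88DeltaLoc234Torus (gLocT)
open BIJ88NeumannPropagatorFlatDecayCube
open BIJ88ConvexWeights227 (cwt)
open BIJ88Cutoffs21 (cutoff)
open BIJ88LocWeights227Torus
open BIJ88LocDeriv230FlatTorus (deriv230_flat_cwt)
open B4Reflection242 (boxDom mem_boxDom)
open B4ContourShift (supNorm abs_le_supNorm supNorm_nonneg exists_supNorm_eq)
open GaugeField (gaugeAct)

noncomputable section

variable {d : ℕ} {P : Params}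

/-! ## §1 Lattice telescoping in a coordinate box of `ℤ^m` under a per-bond bound -/

section Telescoping

variable {m : ℕ} {E : Type*} [SeminormedAddCommGroup E]

/-- kernel: the `ℓ¹` size of a difference after one unit step down in the coordinate `i`. [folklore] -/
private theorem sum_natAbs_sub_single (z w : Fin m → ℤ) (i : Fin m) (hi : w i < z i) :
    ∑ j, (w j - (z - Pi.single i 1 : Fin m → ℤ) j).natAbs + 1 = ∑ j, (w j - z j).natAbs := by
  rw [← Finset.add_sum_erase _ _ (Finset.mem_univ i), ← Finset.add_sum_erase _ (fun j => (w j - z j).natAbs) (Finset.mem_univ i)]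
  have h1 : ∑ j ∈ Finset.univ.erase i, (w j - (z - Pi.single i 1 : Fin m → ℤ) j).natAbs = ∑ j ∈ Finset.univ.erase i, (w j - z j).natAbs :=
    Finset.sum_congr rfl fun j hj => by
      rw [Pi.sub_apply, Pi.single_eq_of_ne (Finset.mem_erase.1 hj).1, sub_zero]
  rw [h1, Pi.sub_apply, Pi.single_eq_same]
  omega

/-- kernel: the `ℓ¹` size of a difference after one unit step up in the coordinate `i`. [folklore] -/
private theorem sum_natAbs_add_single (z w : Fin m → ℤ) (i : Fin m) (hi : z i < w i) :
    ∑ j, (w j - (z + Pi.single i 1 : Fin m → ℤ) j).natAbs + 1 = ∑ j, (w j - z j).natAbs := by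
  rw [← Finset.add_sum_erase _ _ (Finset.mem_univ i), ← Finset.add_sum_erase _ (fun j => (w j - z j).natAbs) (Finset.mem_univ i)]
  have h1 : ∑ j ∈ Finset.univ.erase i, (w j - (z + Pi.single i 1 : Fin m → ℤ) j).natAbs = ∑ j ∈ Finset.univ.erase i, (w j - z j).natAbs :=
    Finset.sum_congr rfl fun j hj => by
      rw [Pi.add_apply, Pi.single_eq_of_ne (Finset.mem_erase.1 hj).1, add_zero]
  rw [h1, Pi.add_apply, Pi.single_eq_same]
  omega

/-- **Lattice telescoping in a coordinate box** (bookkeeping for the staircase contours `Γ_{x,x′}` of [6] (1.9) read in a chart): if a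
function `Ψ` on `ℤ^m` changes by at most `B` across every lattice bond `⟨z, z + e_i⟩` with both endpoints in the box `Π_j[lo_j, hi_j]`, then for
all `z, w` in the box `‖Ψ(w) − Ψ(z)‖ ≤ B·|w − z|₁` — a coordinate-monotone staircase from `z` to `w` stays in the box.
[cite: Balaban1983RegularityDecay, (1.9) p.573, dictionary] -/
theorem norm_sub_le_mul_l1_of_bond_bound (lo hi : Fin m → ℤ) (Ψ : (Fin m → ℤ) → E) {B : ℝ}
    (hbond : ∀ (z : Fin m → ℤ) (i : Fin m), (∀ j, lo j ≤ z j ∧ z j ≤ hi j) → z i + 1 ≤ hi i →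
      ‖Ψ (z + Pi.single i 1) - Ψ z‖ ≤ B)
    {z w : Fin m → ℤ} (hz : ∀ j, lo j ≤ z j ∧ z j ≤ hi j) (hw : ∀ j, lo j ≤ w j ∧ w j ≤ hi j) :
    ‖Ψ w - Ψ z‖ ≤ B * ∑ j, ((|w j - z j| : ℤ) : ℝ) := by
  suffices H : ∀ (N : ℕ) (z : Fin m → ℤ), (∑ j, (w j - z j).natAbs) = N → (∀ j, lo j ≤ z j ∧ z j ≤ hi j) → ‖Ψ w - Ψ z‖ ≤ B * N by
    have h := H _ z rfl hz
    have e : ((∑ j, (w j - z j).natAbs : ℕ) : ℝ) = ∑ j, ((|w j - z j| : ℤ) : ℝ) := by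
      push_cast
      exact Finset.sum_congr rfl fun j _ => by rw [Nat.cast_natAbs, Int.cast_abs, Int.cast_sub]
    rw [← e]; exact h
  intro N
  induction N with
  | zero =>
      intro z hN hz'
      have hzw : w = z := by
        funext j
        have h0 := (Finset.sum_eq_zero_iff.1 hN) j (Finset.mem_univ j)
        omega
      rw [hzw, sub_self, norm_zero, Nat.cast_zero, mul_zero]
  | succ N ih =>
      intro z hN hz'
      obtain ⟨i, hne⟩ : ∃ i, w i ≠ z i := by
        by_contra hne
        push Not at hne
        have h0 : ∑ j, (w j - z j).natAbs = 0 := Finset.sum_eq_zero fun j _ => by rw [hne j, sub_self]; rfl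
        omega
      rcases lt_or_gt_of_ne hne with hlt | hgt
      · -- step down: the bond from `z − e_i` to `z`
        set z' : Fin m → ℤ := z - Pi.single i 1 with hz'def
        have hbox : ∀ j, lo j ≤ z' j ∧ z' j ≤ hi j := by
          intro j
          by_cases hji : j = i
          · subst hji
            rw [hz'def, Pi.sub_apply, Pi.single_eq_same]
            have := hz' j; have := hw j
            constructor <;> omega
          · rw [hz'def, Pi.sub_apply, Pi.single_eq_of_ne hji, sub_zero]; exact hz' j
        have hN' : ∑ j, (w j - z' j).natAbs = N := by
          have h := sum_natAbs_sub_single z w i hlt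
          rw [← hz'def] at h
          omega
        have hstep : ‖Ψ z - Ψ z'‖ ≤ B := by
          have e : z = z' + Pi.single i 1 := by rw [hz'def, sub_add_cancel]
          have h := hbond z' i hbox (by rw [hz'def, Pi.sub_apply, Pi.single_eq_same]; have := hz' i; omega)
          rw [← e] at h
          exact h
        calc ‖Ψ w - Ψ z‖ = ‖(Ψ w - Ψ z') - (Ψ z - Ψ z')‖ := by rw [sub_sub_sub_cancel_right]
          _ ≤ ‖Ψ w - Ψ z'‖ + ‖Ψ z - Ψ z'‖ := norm_sub_le _ _
          _ ≤ B * N + B := add_le_add (ih z' hN' hbox) hstep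
          _ = B * (N + 1 : ℕ) := by push_cast; ring
      · -- step up: the bond from `z` to `z + e_i`
        set z' : Fin m → ℤ := z + Pi.single i 1 with hz'def
        have hbox : ∀ j, lo j ≤ z' j ∧ z' j ≤ hi j := by
          intro j
          by_cases hji : j = i
          · subst hji
            rw [hz'def, Pi.add_apply, Pi.single_eq_same]
            have := hz' j; have := hw j
            constructor <;> omega
          · rw [hz'def, Pi.add_apply, Pi.single_eq_of_ne hji, add_zero]; exact hz' j
        have hN' : ∑ j, (w j - z' j).natAbs = N := by
          have h := sum_natAbs_add_single z w i hgt
          rw [← hz'def] at h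
          omega
        have hstep : ‖Ψ z' - Ψ z‖ ≤ B := hbond z i hz' (by have := hw i; omega)
        calc ‖Ψ w - Ψ z‖ = ‖(Ψ w - Ψ z') + (Ψ z' - Ψ z)‖ := by rw [sub_add_sub_cancel]
          _ ≤ ‖Ψ w - Ψ z'‖ + ‖Ψ z' - Ψ z‖ := norm_add_le _ _
          _ ≤ B * N + B := add_le_add (ih z' hN' hbox) hstep
          _ = B * (N + 1 : ℕ) := by push_cast; ring

end Telescoping

/-! ## §2 Pure-gauge transport: `u(b) = h(b₋)h(b₊)⁻¹`, the rotated function `Φ = h̄ψ`, and the transported difference -/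

section Transport

variable {j : ℕ}

/-- **At the pure-gauge background `u = 1^h` the bond variable is `u(b) = h(b₋)h(b₊)⁻¹`** (r18's `cfg`, the tree's `gaugeAct`), so the parallel
transport along ANY contour from `x′` to `x` is `h(x)h(x′)⁻¹` — the `U(A(Γ_{x,x′}))` of [6] (1.9) at `A = 0` up to gauge.
[cite: Balaban1983RegularityDecay, (1.9) p.573] -/
theorem cfg_gaugeAct_one (h : GaugeTransf P j U1) (b : PBond P j) :
    cfg (gaugeAct h (1 : GaugeField P j U1)) b = toC (h b.src) * (toC (h b.tgt))⁻¹ := by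
  show toC (gaugeAct h 1 b) = _
  rw [toC_gaugeAct]
  show toC (h b.src) * toC 1 * (toC (h b.tgt))⁻¹ = _
  rw [toC_one, mul_one]

/-- **One bond of the rotated function**: with `Φ = h̄ψ`, `Φ(b₊) − Φ(b₋) = h(b₋)⁻¹·c⁻¹·(D^c_uψ)(b)` at `u = 1^h` (`D^c_uψ(b) = c(u(b)ψ(b₊) − ψ(b₋))`,
r18's `covD`, `c ≠ 0`). [cite: Balaban1983RegularityDecay, (1.9) p.573] -/
theorem rot_tgt_sub_rot_src (h : GaugeTransf P j U1) {c : ℝ} (hc : c ≠ 0) (ψ : Balaban1983to89.Site P j → ℂ) (b : PBond P j) :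
    (toC (h b.tgt))⁻¹ * ψ b.tgt - (toC (h b.src))⁻¹ * ψ b.src =
      (toC (h b.src))⁻¹ * ((c : ℂ)⁻¹ * covD c (cfg (gaugeAct h (1 : GaugeField P j U1))) ψ b) := by
  simp only [covD]
  rw [cfg_gaugeAct_one]
  have h1 : toC (h b.src) ≠ 0 := toC_ne_zero _
  have h2 : toC (h b.tgt) ≠ 0 := toC_ne_zero _
  have hc' : (c : ℂ) ≠ 0 := by exact_mod_cast hc
  field_simp

/-- the norm form: `‖Φ(b₊) − Φ(b₋)‖ = |c|⁻¹·‖(D^c_uψ)(b)‖` (`|h| = 1`). [cite: Balaban1983RegularityDecay, (1.9) p.573] -/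
theorem norm_rot_tgt_sub_rot_src (h : GaugeTransf P j U1) {c : ℝ} (hc : c ≠ 0) (ψ : Balaban1983to89.Site P j → ℂ) (b : PBond P j) :
    ‖(toC (h b.tgt))⁻¹ * ψ b.tgt - (toC (h b.src))⁻¹ * ψ b.src‖ = |c|⁻¹ * ‖covD c (cfg (gaugeAct h (1 : GaugeField P j U1))) ψ b‖ := by
  rw [rot_tgt_sub_rot_src h hc ψ b, norm_mul, norm_mul, norm_inv, norm_toC, inv_one, one_mul, norm_inv, Complex.norm_real,
    Real.norm_eq_abs]

/-- **The transported difference is the rotated plain difference**: `h(x₁)h(x₂)⁻¹ψ(x₂) − ψ(x₁) = h(x₁)·(Φ(x₂) − Φ(x₁))`, `Φ = h̄ψ`.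
[cite: Balaban1983RegularityDecay, (1.9) p.573] -/
theorem transport_sub_eq (h : GaugeTransf P j U1) (ψ : Balaban1983to89.Site P j → ℂ) (x₁ x₂ : Balaban1983to89.Site P j) :
    toC (h x₁) * (toC (h x₂))⁻¹ * ψ x₂ - ψ x₁ = toC (h x₁) * ((toC (h x₂))⁻¹ * ψ x₂ - (toC (h x₁))⁻¹ * ψ x₁) := by
  have h1 : toC (h x₁) ≠ 0 := toC_ne_zero _
  rw [mul_sub, ← mul_assoc, ← mul_assoc, mul_inv_cancel₀ h1, one_mul]

/-- the norm form: `‖h(x₁)h(x₂)⁻¹ψ(x₂) − ψ(x₁)‖ = ‖Φ(x₂) − Φ(x₁)‖`. [cite: Balaban1983RegularityDecay, (1.9) p.573] -/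
theorem norm_transport_sub (h : GaugeTransf P j U1) (ψ : Balaban1983to89.Site P j → ℂ) (x₁ x₂ : Balaban1983to89.Site P j) :
    ‖toC (h x₁) * (toC (h x₂))⁻¹ * ψ x₂ - ψ x₁‖ = ‖(toC (h x₂))⁻¹ * ψ x₂ - (toC (h x₁))⁻¹ * ψ x₁‖ := by
  rw [transport_sub_eq, norm_mul, norm_toC, one_mul]

end Transport

/-! ## §3 The Hölder member of order `θ ≤ 1` of (2.30) at flat backgrounds FOR THE PRINTED DATA -/

section Holder

/-- kernel: for `1 ≤ t` and `θ ≤ 1`, `t^θ ≤ t`. [folklore] -/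
private theorem rpow_le_self_of_one_le {t θ : ℝ} (ht : 1 ≤ t) (hθ : θ ≤ 1) : t ^ θ ≤ t := by
  have h := Real.rpow_le_rpow_of_exponent_le ht hθ
  rwa [Real.rpow_one] at h

set_option maxHeartbeats 400000 in
/-- **THE HÖLDER MEMBER OF ORDER `θ ≤ 1` OF (2.30) AT EVERY PURE-GAUGE BACKGROUND `u = 1^h`, FOR THE PRINTED LOCALIZATION DATA** (p. 263:
*"Bounds analogous to (2.30), (2.31) hold for covariant derivatives and Holder derivatives of G_{k,loc}(u) of order less than two"*, the
(2.30)-analogue for the Hölder quotients of the values).  THERE EXIST `δ₀, c₀ > 0` depending on `(d, ℓ, a)` only such that for every volume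
(`P.d = d+1`, `P.L = ℓ+1`), every `1 ≤ k ≤ K`, every no-wrap box `Ω₀ = c·L^k + Π_i[0, L^k·M₀_i)` shorter than the torus leaving torus gaps `≥ R`
and `≥ R₀`, every cube spacing `s ≥ 1` and half-width `W ≥ 2s/3 + R₀/2 + R`, radii `1 < R`, `0 ≤ R₁ < R₀` with `L^k ≤ R₀`, every pure gauge `h`,
EVERY exponent `0 ≤ θ ≤ 1`, all fine sites `x₁, x₂ ∈ Ω₀` at chart depth `≥ R₀`, and every source `f` with `‖f‖_∞ ≤ F` supported at sup-torus
distance `≥ D ≥ 0` from `x₁` and from `x₂`: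
`(L^k/|x₁ − x₂|_T)^θ·‖h(x₁)h(x₂)⁻¹(G_{k,loc}(1^h)f)(x₂) − (G_{k,loc}(1^h)f)(x₁)‖ ≤ (L^kε)²·c₀·m·(1 + L^k·((R₀ − R₁)⁻¹ + s⁻¹))·e^{−δ₀D/L^k}·F`,
`m = (⌊(L^k − 1 + R₀)/s⌋ + 3)^{d+1}`, where `G_{k,loc}(1^h)` is built from the torus cubes `{□_α}`, the weights `λ_α` of (2.27) and the cut-off
`ζ″` of (2.29) of gen 26, `h(x₁)h(x₂)⁻¹` is the pure-gauge parallel transport along any contour from `x₂` to `x₁` ([6] (1.9)) and `|x₁−x₂|_T/L^k`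
the distance in [6]'s level-`k` units — gen 27's derivative member telescoped along a staircase inside `Ω₀` for near pairs, two value members
for far pairs. [cite: BalabanImbrieJaffe1988, (2.30) p.263] -/
theorem holder230_flat_cwt (d ℓ : ℕ) (hℓ : 1 ≤ ℓ) {a : ℝ} (ha : 0 < a) :
    ∃ δ₀ c₀ : ℝ, 0 < δ₀ ∧ 0 < c₀ ∧ ∀ (P : Params) (hPd : P.d = d + 1), P.L = ℓ + 1 →
      ∀ k : ℕ, 1 ≤ k → k ≤ P.K → ∀ (c M0 : Fin (d + 1) → ℕ), (∀ i, 1 ≤ M0 i) →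
        (∀ i, c i * P.L ^ k + P.L ^ k * M0 i ≤ P.sitesPerDir 0) → (∀ i, P.L ^ k * M0 i < P.sitesPerDir 0) →
      ∀ (s W : ℕ), 1 ≤ s → ∀ (R R₀ R₁ : ℝ), 1 < R → 0 ≤ R₁ → R₁ < R₀ → 2 * (s : ℝ) / 3 + R₀ / 2 + R ≤ W →
        (∀ i, ((P.L ^ k * M0 i : ℕ) : ℝ) + R ≤ P.sitesPerDir 0) → (∀ i, ((P.L ^ k * M0 i : ℕ) : ℝ) + R₀ ≤ P.sitesPerDir 0) →
        (P.L : ℝ) ^ k ≤ R₀ →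
      ∀ (h : GaugeTransf P 0 U1) (θ : ℝ), 0 ≤ θ → θ ≤ 1 →
      ∀ (x₁ x₂ : Balaban1983to89.Site P 0),
        x₁ ∈ (cubeT hPd (P.L ^ k) c fun i => P.L ^ k * M0 i) →
        (∀ i, R₀ ≤ (boxCoord hPd (P.L ^ k) c x₁ i : ℝ) ∧ (boxCoord hPd (P.L ^ k) c x₁ i : ℝ) + R₀ ≤ (P.L ^ k * M0 i : ℕ) - 1) →
        x₂ ∈ (cubeT hPd (P.L ^ k) c fun i => P.L ^ k * M0 i) →
        (∀ i, R₀ ≤ (boxCoord hPd (P.L ^ k) c x₂ i : ℝ) ∧ (boxCoord hPd (P.L ^ k) c x₂ i : ℝ) + R₀ ≤ (P.L ^ k * M0 i : ℕ) - 1) →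
      ∀ (f : Balaban1983to89.Site P 0 → ℂ) (F D : ℝ), (∀ y, ‖f y‖ ≤ F) → 0 ≤ D →
        (∀ y, f y ≠ 0 → D ≤ B5Ineq137Torus.T P 0 x₁ y) → (∀ y, f y ≠ 0 → D ≤ B5Ineq137Torus.T P 0 x₂ y) →
        ((P.L : ℝ) ^ k / B5Ineq137Torus.T P 0 x₁ x₂) ^ θ *
          ‖toC (h x₁) * (toC (h x₂))⁻¹ *
              (gLocT (B1RG242Torus.α P a k * (P.L : ℝ) ^ (k * P.d)) P.eps⁻¹ (gaugeAct h (1 : GaugeField P 0 U1)) k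
                (cubeFam hPd (P.L ^ k) c M0 s W) (lamFam hPd (P.L ^ k) c M0 s) (cutoff R₁ R₀ (B5Ineq137Torus.T P 0)) *ᵥ f) x₂ -
            (gLocT (B1RG242Torus.α P a k * (P.L : ℝ) ^ (k * P.d)) P.eps⁻¹ (gaugeAct h (1 : GaugeField P 0 U1)) k
                (cubeFam hPd (P.L ^ k) c M0 s W) (lamFam hPd (P.L ^ k) c M0 s) (cutoff R₁ R₀ (B5Ineq137Torus.T P 0)) *ᵥ f) x₁‖ ≤
          P.spacing k ^ 2 * (c₀ * (⌊(((P.L : ℝ) ^ k) - 1 + R₀) / s⌋₊ + 3) ^ (d + 1) *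
            (1 + (P.L : ℝ) ^ k * ((R₀ - R₁)⁻¹ + (s : ℝ)⁻¹)) * Real.exp (-(δ₀ * (((P.L : ℝ) ^ k)⁻¹ * D))) * F) := by
  obtain ⟨δ₁, c₁, hδ₁, hc₁, H1⟩ := deriv230_flat_cwt d ℓ hℓ ha
  obtain ⟨δ₂, c₂, hδ₂, hc₂, H2⟩ := opDecay230_flat_cwt d ℓ hℓ ha
  refine ⟨min δ₁ δ₂, max (((d : ℝ) + 1) * Real.exp δ₁ * c₁) (2 * c₂), lt_min hδ₁ hδ₂, lt_max_of_lt_right (by positivity), ?_⟩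
  intro P hPd hPL k hk1 hkK c M0 hM0 hfit0 hN0 s W hs R R₀ R₁ hR hR₁ hR10 hW hgapR hgapR₀ hLR₀ h θ hθ0 hθ1 x₁ x₂ hx₁ hdeep₁ hx₂ hdeep₂
    f F D hF hD hsupp₁ hsupp₂
  set δ := min δ₁ δ₂ with hδdef
  set C := max (((d : ℝ) + 1) * Real.exp δ₁ * c₁) (2 * c₂) with hCdef
  have hδ1 : δ ≤ δ₁ := min_le_left _ _
  have hδ2 : δ ≤ δ₂ := min_le_right _ _
  have hC1 : ((d : ℝ) + 1) * Real.exp δ₁ * c₁ ≤ C := le_max_left _ _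
  have hC2 : 2 * c₂ ≤ C := le_max_right _ _
  have hC0 : 0 ≤ C := le_trans (by positivity) hC2
  have hLpos : (0 : ℝ) < P.L := P.cast_L_pos
  have hLk : (0 : ℝ) < (P.L : ℝ) ^ k := pow_pos hLpos _
  have hLkinv : 0 < ((P.L : ℝ) ^ k)⁻¹ := inv_pos.mpr hLk
  have hF0 : 0 ≤ F := (norm_nonneg _).trans (hF x₁)
  have hsp0 : 0 < P.spacing k := P.spacing_pos k
  have heps : 0 < P.eps := P.eps_pos
  have hsr : (0 : ℝ) < s := by exact_mod_cast hs
  have hgap' : 0 < R₀ - R₁ := sub_pos.2 hR10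
  have hT0 : 0 ≤ B5Ineq137Torus.T P 0 x₁ x₂ := B5Ineq137Torus.T_nonneg P 0 x₁ x₂
  -- abbreviations
  set A : ℝ := B1RG242Torus.α P a k * (P.L : ℝ) ^ (k * P.d) with hAdef
  set U : GaugeField P 0 U1 := gaugeAct h (1 : GaugeField P 0 U1) with hUdef
  set ζ := cutoff R₁ R₀ (B5Ineq137Torus.T P 0) with hζdef
  set ψ : Balaban1983to89.Site P 0 → ℂ :=
    gLocT A P.eps⁻¹ U k (cubeFam hPd (P.L ^ k) c M0 s W) (lamFam hPd (P.L ^ k) c M0 s) ζ *ᵥ f with hψdef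
  set T12 : ℝ := B5Ineq137Torus.T P 0 x₁ x₂ with hT12def
  set m : ℝ := ((⌊(((P.L : ℝ) ^ k) - 1 + R₀) / s⌋₊ : ℝ) + 3) ^ (d + 1) with hmdef
  have hm0 : 0 ≤ m := by rw [hmdef]; positivity
  set br : ℝ := 1 + (P.L : ℝ) ^ k * ((R₀ - R₁)⁻¹ + (s : ℝ)⁻¹) with hbrdef
  have hbr1 : 1 ≤ br := by rw [hbrdef]; exact le_add_of_nonneg_right (by positivity)
  have hbr0 : 0 ≤ br := zero_le_one.trans hbr1
  set Ex : ℝ := Real.exp (-(δ * (((P.L : ℝ) ^ k)⁻¹ * D))) with hEdef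
  have hE0 : 0 < Ex := Real.exp_pos _
  have hεD : 0 ≤ ((P.L : ℝ) ^ k)⁻¹ * D := mul_nonneg hLkinv.le hD
  have hE1 : Real.exp (-(δ₁ * (((P.L : ℝ) ^ k)⁻¹ * D))) ≤ Ex := Real.exp_le_exp.2 (by nlinarith)
  have hE2 : Real.exp (-(δ₂ * (((P.L : ℝ) ^ k)⁻¹ * D))) ≤ Ex := Real.exp_le_exp.2 (by nlinarith)
  -- the weight
  set w : ℝ := ((P.L : ℝ) ^ k / T12) ^ θ with hwdef
  have hw0 : 0 ≤ w := Real.rpow_nonneg (div_nonneg hLk.le hT0) θ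
  -- the Φ-form of the transported difference
  rw [norm_transport_sub]
  -- the target, factorised
  have hRHS : P.spacing k ^ 2 * (C * m * br * Ex * F) =
      P.spacing k ^ 2 * (C * (⌊(((P.L : ℝ) ^ k) - 1 + R₀) / s⌋₊ + 3) ^ (d + 1) *
        (1 + (P.L : ℝ) ^ k * ((R₀ - R₁)⁻¹ + (s : ℝ)⁻¹)) * Real.exp (-(δ * (((P.L : ℝ) ^ k)⁻¹ * D))) * F) := by
    rw [hmdef, hbrdef, hEdef]
  rw [← hRHS]
  by_cases hnear : T12 ≤ (P.L : ℝ) ^ k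
  · /- NEAR PAIRS: telescoping along a staircase in the chart -/
    -- chart coordinates of the two points
    obtain ⟨hz₁, hxz₁⟩ := cubePt_boxCoord hPd hfit0 hx₁
    obtain ⟨hz₂, hxz₂⟩ := cubePt_boxCoord hPd hfit0 hx₂
    set z₁ := boxCoord hPd (P.L ^ k) c x₁ with hz₁def
    set z₂ := boxCoord hPd (P.L ^ k) c x₂ with hz₂def
    -- torus-close and deep ⇒ chart-close
    have hdeepT : ∀ i, T12 ≤ (z₁ i : ℝ) ∧ (z₁ i : ℝ) + T12 ≤ (P.L ^ k * M0 i : ℕ) - 1 := fun i => by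
      have h1 := hdeep₁ i
      constructor <;> linarith [h1.1, h1.2]
    have hclose : ∀ i, ((|z₁ i - z₂ i| : ℤ) : ℝ) ≤ T12 := (mem_and_abs_sub_le_of_T_le hPd hfit0 hdeepT le_rfl).2
    -- the box: the coordinate hull of `z₁`, `z₂`
    set lo : Fin (d + 1) → ℤ := fun j => min (z₁ j) (z₂ j) with hlodef
    set hi : Fin (d + 1) → ℤ := fun j => max (z₁ j) (z₂ j) with hhidef
    have hz₁box : ∀ j, lo j ≤ z₁ j ∧ z₁ j ≤ hi j := fun j => ⟨min_le_left _ _, le_max_left _ _⟩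
    have hz₂box : ∀ j, lo j ≤ z₂ j ∧ z₂ j ≤ hi j := fun j => ⟨min_le_right _ _, le_max_right _ _⟩
    -- every hull point is in the box `Ω₀`, deep, and chart-close to `z₁`
    have hullDom : ∀ z : Fin (d + 1) → ℤ, (∀ j, lo j ≤ z j ∧ z j ≤ hi j) → z ∈ boxDom (fun i => P.L ^ k * M0 i) := by
      intro z hz
      rw [mem_boxDom]
      intro i
      have h1 := (mem_boxDom.1 hz₁) i; have h2 := (mem_boxDom.1 hz₂) i; have h3 := hz i
      simp only [hlodef, hhidef] at h3
      constructor <;> omega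
    have hullDeep : ∀ z : Fin (d + 1) → ℤ, (∀ j, lo j ≤ z j ∧ z j ≤ hi j) →
        ∀ i, R₀ ≤ (boxCoord hPd (P.L ^ k) c (cubePt hPd (P.L ^ k) c z) i : ℝ) ∧
          (boxCoord hPd (P.L ^ k) c (cubePt hPd (P.L ^ k) c z) i : ℝ) + R₀ ≤ (P.L ^ k * M0 i : ℕ) - 1 := by
      intro z hz i
      rw [boxCoord_cubePt hPd hfit0 (hullDom z hz)]
      have h1 := hdeep₁ i; have h2 := hdeep₂ i; have h3 := hz i
      simp only [hlodef, hhidef] at h3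
      rcases le_total (z₁ i) (z₂ i) with h12 | h12
      · rw [min_eq_left h12, max_eq_right h12] at h3
        have h4 : (z₁ i : ℝ) ≤ z i := by exact_mod_cast h3.1
        have h5 : (z i : ℝ) ≤ z₂ i := by exact_mod_cast h3.2
        exact ⟨h1.1.trans h4, by linarith [h2.2]⟩
      · rw [min_eq_right h12, max_eq_left h12] at h3
        have h4 : (z₂ i : ℝ) ≤ z i := by exact_mod_cast h3.1
        have h5 : (z i : ℝ) ≤ z₁ i := by exact_mod_cast h3.2
        exact ⟨h2.1.trans h4, by linarith [h1.2]⟩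
    have hullClose : ∀ z : Fin (d + 1) → ℤ, (∀ j, lo j ≤ z j ∧ z j ≤ hi j) → supNorm (z₁ - z) ≤ T12 := by
      intro z hz
      obtain ⟨i, hi'⟩ := exists_supNorm_eq (z₁ - z)
      rw [hi', Pi.sub_apply]
      refine le_trans ?_ (hclose i)
      have h3 := hz i
      simp only [hlodef, hhidef] at h3
      have key : |z₁ i - z i| ≤ |z₁ i - z₂ i| := by
        rw [abs_le]
        rcases le_total (z₁ i) (z₂ i) with h12 | h12
        · rw [min_eq_left h12, max_eq_right h12] at h3
          rw [abs_of_nonpos (by omega : z₁ i - z₂ i ≤ 0)]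
          constructor <;> omega
        · rw [min_eq_right h12, max_eq_left h12] at h3
          rw [abs_of_nonneg (by omega : 0 ≤ z₁ i - z₂ i)]
          constructor <;> omega
      exact_mod_cast key
    -- the rotated function read in the chart
    set Ψ : (Fin (d + 1) → ℤ) → ℂ := fun z => (toC (h (cubePt hPd (P.L ^ k) c z)))⁻¹ * ψ (cubePt hPd (P.L ^ k) c z) with hΨdef
    -- the shortened support distance along the hull
    set D' : ℝ := max (D - T12) 0 with hD'def
    have hD'0 : 0 ≤ D' := le_max_right _ _
    have hD'supp : ∀ z : Fin (d + 1) → ℤ, (∀ j, lo j ≤ z j ∧ z j ≤ hi j) →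
        ∀ y, f y ≠ 0 → D' ≤ B5Ineq137Torus.T P 0 (cubePt hPd (P.L ^ k) c z) y := by
      intro z hz y hy
      refine max_le ?_ (B5Ineq137Torus.T_nonneg P 0 _ y)
      have h1 := hsupp₁ y hy
      have h2 := B5Ineq137Torus.T_triangle P 0 x₁ (cubePt hPd (P.L ^ k) c z) y
      have h3 : B5Ineq137Torus.T P 0 x₁ (cubePt hPd (P.L ^ k) c z) ≤ T12 := by
        have h4 := T_cubePt_le hPd hfit0 hz₁ (hullDom z hz)
        rw [hxz₁] at h4
        exact h4.trans (hullClose z hz)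
      linarith
    -- the per-bond bound from gen 27's derivative member
    set B₁ : ℝ := P.spacing k * (c₁ * (⌊(((P.L : ℝ) ^ k) - 1 + R₀) / s⌋₊ + 3) ^ (d + 1) *
      (1 + (P.L : ℝ) ^ k * ((R₀ - R₁)⁻¹ + (s : ℝ)⁻¹)) * Real.exp (-(δ₁ * (((P.L : ℝ) ^ k)⁻¹ * D'))) * F) with hB₁def
    have hB₁0 : 0 ≤ B₁ := by rw [hB₁def]; positivity
    have hbond : ∀ (z : Fin (d + 1) → ℤ) (i : Fin (d + 1)), (∀ j, lo j ≤ z j ∧ z j ≤ hi j) → z i + 1 ≤ hi i →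
        ‖Ψ (z + Pi.single i 1) - Ψ z‖ ≤ P.eps * B₁ := by
      intro z i hz hzi
      have hz' : ∀ j, lo j ≤ (z + Pi.single i 1 : Fin (d + 1) → ℤ) j ∧ (z + Pi.single i 1 : Fin (d + 1) → ℤ) j ≤ hi j := by
        intro j
        by_cases hji : j = i
        · subst hji; rw [Pi.add_apply, Pi.single_eq_same]; have := hz j; constructor <;> omega
        · rw [Pi.add_apply, Pi.single_eq_of_ne hji, add_zero]; exact hz j
      set x : Balaban1983to89.Site P 0 := cubePt hPd (P.L ^ k) c z with hxdef
      set μ : Fin P.d := Fin.cast hPd.symm i with hμdef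
      have hxe : x.shift μ = cubePt hPd (P.L ^ k) c (z + Pi.single i 1) := by rw [cubePt_add_single]
      have hxmem : x ∈ (cubeT hPd (P.L ^ k) c fun i => P.L ^ k * M0 i) := cubePt_mem_cubeT hPd (hullDom z hz)
      have hxemem : x.shift μ ∈ (cubeT hPd (P.L ^ k) c fun i => P.L ^ k * M0 i) := by
        rw [hxe]; exact cubePt_mem_cubeT hPd (hullDom _ hz')
      have hxdeep := hullDeep z hz
      have hxedeep : ∀ i', R₀ ≤ (boxCoord hPd (P.L ^ k) c (x.shift μ) i' : ℝ) ∧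
          (boxCoord hPd (P.L ^ k) c (x.shift μ) i' : ℝ) + R₀ ≤ (P.L ^ k * M0 i' : ℕ) - 1 := by
        rw [hxe]; exact hullDeep _ hz'
      have hderiv := H1 P hPd hPL k hk1 hkK c M0 hM0 hfit0 hN0 s W hs R R₀ R₁ hR hR₁ hR10 hW hgapR h x μ hxmem hxdeep hxemem hxedeep
        f F D' hF hD'0 (hD'supp z hz)
      -- `Ψ(z + e_i) − Ψ(z) = Φ(b₊) − Φ(b₋)` for the bond `b = ⟨x, μ⟩`
      have hsrc : (⟨x, μ⟩ : PBond P 0).src = x := rfl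
      have htgt : (⟨x, μ⟩ : PBond P 0).tgt = cubePt hPd (P.L ^ k) c (z + Pi.single i 1) := hxe
      have hΨ : Ψ (z + Pi.single i 1) - Ψ z =
          (toC (h (⟨x, μ⟩ : PBond P 0).tgt))⁻¹ * ψ (⟨x, μ⟩ : PBond P 0).tgt - (toC (h (⟨x, μ⟩ : PBond P 0).src))⁻¹ * ψ (⟨x, μ⟩ : PBond P 0).src := by
        rw [hsrc, htgt]
      rw [hΨ, norm_rot_tgt_sub_rot_src h (inv_ne_zero heps.ne') ψ ⟨x, μ⟩, abs_inv, abs_of_pos heps, inv_inv]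
      exact mul_le_mul_of_nonneg_left hderiv heps.le
    -- telescoping
    have htel := norm_sub_le_mul_l1_of_bond_bound lo hi Ψ hbond hz₁box hz₂box
    have hl1 : ∑ j, ((|z₂ j - z₁ j| : ℤ) : ℝ) ≤ ((d : ℝ) + 1) * T12 := by
      calc ∑ j, ((|z₂ j - z₁ j| : ℤ) : ℝ) ≤ ∑ _j : Fin (d + 1), T12 :=
            Finset.sum_le_sum fun j _ => by rw [abs_sub_comm]; exact hclose j
        _ = ((d : ℝ) + 1) * T12 := by rw [Finset.sum_const, Finset.card_univ, Fintype.card_fin, nsmul_eq_mul]; push_cast; ring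
    have hΨ₁ : Ψ z₁ = (toC (h x₁))⁻¹ * ψ x₁ := by simp only [hΨdef]; rw [hxz₁]
    have hΨ₂ : Ψ z₂ = (toC (h x₂))⁻¹ * ψ x₂ := by simp only [hΨdef]; rw [hxz₂]
    have hdiff : ‖(toC (h x₂))⁻¹ * ψ x₂ - (toC (h x₁))⁻¹ * ψ x₁‖ ≤ P.eps * B₁ * (((d : ℝ) + 1) * T12) := by
      rw [← hΨ₁, ← hΨ₂]
      exact htel.trans (mul_le_mul_of_nonneg_left hl1 (by positivity))
    -- the exponent: `D' ≥ D − T12 ≥ D − L^k`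
    have hexpD' : Real.exp (-(δ₁ * (((P.L : ℝ) ^ k)⁻¹ * D'))) ≤ Real.exp δ₁ * Ex := by
      have h1 : D - T12 ≤ D' := le_max_left _ _
      have h2 : ((P.L : ℝ) ^ k)⁻¹ * T12 ≤ 1 := by
        rw [inv_mul_le_iff₀ hLk, mul_one]; exact hnear
      have h3 : -(δ₁ * (((P.L : ℝ) ^ k)⁻¹ * D')) ≤ δ₁ + -(δ * (((P.L : ℝ) ^ k)⁻¹ * D)) := by
        have h4 : δ₁ * (((P.L : ℝ) ^ k)⁻¹ * (D - T12)) ≤ δ₁ * (((P.L : ℝ) ^ k)⁻¹ * D') :=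
          mul_le_mul_of_nonneg_left (mul_le_mul_of_nonneg_left h1 hLkinv.le) hδ₁.le
        have h5 : δ * (((P.L : ℝ) ^ k)⁻¹ * D) ≤ δ₁ * (((P.L : ℝ) ^ k)⁻¹ * D) := mul_le_mul_of_nonneg_right hδ1 hεD
        have h6 : δ₁ * (((P.L : ℝ) ^ k)⁻¹ * T12) ≤ δ₁ * 1 := mul_le_mul_of_nonneg_left h2 hδ₁.le
        have h7 : δ₁ * (((P.L : ℝ) ^ k)⁻¹ * (D - T12)) = δ₁ * (((P.L : ℝ) ^ k)⁻¹ * D) - δ₁ * (((P.L : ℝ) ^ k)⁻¹ * T12) := by ring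
        linarith
      calc Real.exp (-(δ₁ * (((P.L : ℝ) ^ k)⁻¹ * D'))) ≤ Real.exp (δ₁ + -(δ * (((P.L : ℝ) ^ k)⁻¹ * D))) := Real.exp_le_exp.2 h3
        _ = Real.exp δ₁ * Ex := by rw [Real.exp_add]
    have hB₁le : B₁ ≤ P.spacing k * (Real.exp δ₁ * c₁ * m * br * Ex * F) := by
      rw [hB₁def]
      refine mul_le_mul_of_nonneg_left ?_ hsp0.le
      have : c₁ * m * br * Real.exp (-(δ₁ * (((P.L : ℝ) ^ k)⁻¹ * D'))) * F ≤ c₁ * m * br * (Real.exp δ₁ * Ex) * F :=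
        mul_le_mul_of_nonneg_right (mul_le_mul_of_nonneg_left hexpD' (by positivity)) hF0
      calc c₁ * m * br * Real.exp (-(δ₁ * (((P.L : ℝ) ^ k)⁻¹ * D'))) * F ≤ c₁ * m * br * (Real.exp δ₁ * Ex) * F := this
        _ = Real.exp δ₁ * c₁ * m * br * Ex * F := by ring
    -- the weight against the number of steps: `w·(d+1)T12·ε ≤ (d+1)·L^k·ε`
    have hwT : w * (P.eps * B₁ * (((d : ℝ) + 1) * T12)) ≤ ((d : ℝ) + 1) * (P.eps * (P.L : ℝ) ^ k) * B₁ := by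
      rcases hT0.eq_or_lt with hT00 | hTpos
      · -- `x₁`, `x₂` at torus distance `0`: no steps
        rw [← hT00, mul_zero, mul_zero, mul_zero]
        positivity
      · have hq : 1 ≤ (P.L : ℝ) ^ k / T12 := by rw [le_div_iff₀ hTpos, one_mul]; exact hnear
        have hw1 : w ≤ (P.L : ℝ) ^ k / T12 := rpow_le_self_of_one_le hq hθ1
        calc w * (P.eps * B₁ * (((d : ℝ) + 1) * T12)) ≤ (P.L : ℝ) ^ k / T12 * (P.eps * B₁ * (((d : ℝ) + 1) * T12)) :=
              mul_le_mul_of_nonneg_right hw1 (by positivity)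
          _ = ((d : ℝ) + 1) * (P.eps * (P.L : ℝ) ^ k) * B₁ := by
              rw [div_mul_eq_mul_div, div_eq_iff hTpos.ne']
              ring
    have hspacing : P.eps * (P.L : ℝ) ^ k = P.spacing k := by rw [Params.spacing]; ring
    calc w * ‖(toC (h x₂))⁻¹ * ψ x₂ - (toC (h x₁))⁻¹ * ψ x₁‖ ≤ w * (P.eps * B₁ * (((d : ℝ) + 1) * T12)) :=
          mul_le_mul_of_nonneg_left hdiff hw0
      _ ≤ ((d : ℝ) + 1) * (P.eps * (P.L : ℝ) ^ k) * B₁ := hwT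
      _ ≤ ((d : ℝ) + 1) * P.spacing k * (P.spacing k * (Real.exp δ₁ * c₁ * m * br * Ex * F)) := by
          rw [hspacing]; exact mul_le_mul_of_nonneg_left hB₁le (by positivity)
      _ = P.spacing k ^ 2 * ((((d : ℝ) + 1) * Real.exp δ₁ * c₁) * m * br * Ex * F) := by ring
      _ ≤ P.spacing k ^ 2 * (C * m * br * Ex * F) := by
          refine mul_le_mul_of_nonneg_left ?_ (sq_nonneg _)
          have : (((d : ℝ) + 1) * Real.exp δ₁ * c₁) * m * br * Ex * F ≤ C * m * br * Ex * F :=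
            mul_le_mul_of_nonneg_right (mul_le_mul_of_nonneg_right (mul_le_mul_of_nonneg_right
              (mul_le_mul_of_nonneg_right hC1 hm0) hbr0) hE0.le) hF0
          exact this
  · /- FAR PAIRS: two value members -/
    push Not at hnear
    have hTpos : 0 < T12 := hLk.trans hnear
    have hw1 : w ≤ 1 := by
      refine Real.rpow_le_one (div_nonneg hLk.le hT0) ?_ hθ0
      rw [div_le_one hTpos]; exact hnear.le
    have hv₁ := H2 P hPd hPL k hk1 hkK c M0 hM0 hfit0 hN0 s W hs R₀ R₁ hR₁ hR10 hgapR₀ h x₁ f F D hF hsupp₁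
    have hv₂ := H2 P hPd hPL k hk1 hkK c M0 hM0 hfit0 hN0 s W hs R₀ R₁ hR₁ hR10 hgapR₀ h x₂ f F D hF hsupp₂
    have hn₁ : ‖(toC (h x₁))⁻¹ * ψ x₁‖ = ‖ψ x₁‖ := by rw [norm_mul, norm_inv, norm_toC, inv_one, one_mul]
    have hn₂ : ‖(toC (h x₂))⁻¹ * ψ x₂‖ = ‖ψ x₂‖ := by rw [norm_mul, norm_inv, norm_toC, inv_one, one_mul]
    have hval : ∀ x : Balaban1983to89.Site P 0,
        ‖ψ x‖ ≤ P.spacing k ^ 2 * (((⌊(((P.L : ℝ) ^ k) - 1 + R₀) / s⌋₊ : ℝ) + 3) ^ (d + 1) *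
          (c₂ * Real.exp (-(δ₂ * (((P.L : ℝ) ^ k)⁻¹ * D))) * F)) → ‖ψ x‖ ≤ P.spacing k ^ 2 * (c₂ * m * Ex * F) := by
      intro x hx
      refine hx.trans (mul_le_mul_of_nonneg_left ?_ (sq_nonneg _))
      rw [← hmdef]
      calc m * (c₂ * Real.exp (-(δ₂ * (((P.L : ℝ) ^ k)⁻¹ * D))) * F) ≤ m * (c₂ * Ex * F) :=
            mul_le_mul_of_nonneg_left (mul_le_mul_of_nonneg_right (mul_le_mul_of_nonneg_left hE2 hc₂.le) hF0) hm0
        _ = c₂ * m * Ex * F := by ring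
    have h1 := hval x₁ hv₁
    have h2 := hval x₂ hv₂
    have hsub : ‖(toC (h x₂))⁻¹ * ψ x₂ - (toC (h x₁))⁻¹ * ψ x₁‖ ≤
        P.spacing k ^ 2 * (c₂ * m * Ex * F) + P.spacing k ^ 2 * (c₂ * m * Ex * F) := by
      refine (norm_sub_le _ _).trans ?_
      rw [hn₁, hn₂]
      exact add_le_add h2 h1
    have hfin : (P.spacing k ^ 2 * (c₂ * m * Ex * F) + P.spacing k ^ 2 * (c₂ * m * Ex * F) : ℝ) ≤ P.spacing k ^ 2 * (C * m * br * Ex * F) := by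
      have e : P.spacing k ^ 2 * (c₂ * m * Ex * F) + P.spacing k ^ 2 * (c₂ * m * Ex * F) =
          P.spacing k ^ 2 * ((2 * c₂) * m * 1 * Ex * F) := by ring
      rw [e]
      refine mul_le_mul_of_nonneg_left ?_ (sq_nonneg _)
      have h3 : (2 * c₂) * m * 1 ≤ C * m * br := mul_le_mul (mul_le_mul_of_nonneg_right hC2 hm0) hbr1 zero_le_one (by positivity)
      exact mul_le_mul_of_nonneg_right (mul_le_mul_of_nonneg_right h3 hE0.le) hF0
    calc w * ‖(toC (h x₂))⁻¹ * ψ x₂ - (toC (h x₁))⁻¹ * ψ x₁‖ ≤ ‖(toC (h x₂))⁻¹ * ψ x₂ - (toC (h x₁))⁻¹ * ψ x₁‖ :=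
          mul_le_of_le_one_left (norm_nonneg _) hw1
      _ ≤ P.spacing k ^ 2 * (c₂ * m * Ex * F) + P.spacing k ^ 2 * (c₂ * m * Ex * F) := hsub
      _ ≤ P.spacing k ^ 2 * (C * m * br * Ex * F) := hfin

end Holder

end

end Literature.MathematicalPhysics.QuantumFieldTheory.BalabanImbrieJaffe1984to88.BIJ88LocHolder230FlatTorus
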